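import Summits.QuantumFields.YangMills.Theorems.BalabanUVNodesN09TowerChartOfPerBondCharts

/-!
# NODE N09 [B12] — THE BASE-POINT SOCKET `hz₀` OF THE (F1) REGULARITY TOWER FOR ROAD A′ RE-BASED ON THE χ-SUPPORT: at `z₀(V) := V^{(j)}(V)` the tower chart returns the
# critical configuration itself — from the LEFT-INVERSE clause of the per-bond inversions on the central `α`-windows, [B7] Prop 2 at the record and numerics

Cell `pub-ymgap` (YM-PLAN Track A), width seat `pub-ymgap-dag-n09-w5` g4 (D-0154 ∕ R399 (3a) width seat 5 of node N09), FILE 5; helper of K1⁹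
`StabilityBRunRowsAtRecordR13SepCoPHV` = stmt-QuantumFields-27364 (`--supports`, `--as helper`, count-neutral).  [I] = [Balaban1987RG1] (CMP 109), [B7] = [Balaban1985Averaging],
[B11] = [Balaban1985Variational].

WHY.  dag-n09-w1 g5's regularity tower (`…N09RegularityTowerOfGeometricChartData.hreg_pos_all_of_geometricChartData`, p622064) asks per step a BASE POINT `z₀ j V` in the fibre
with `hz₀ : Φ j (V, z₀ j V) = V^{(j)}(V)` (then `hΦc`, `hJpos` around it).  For the re-based road-A′ chart `Φ′ = A.piecewise Φ_tri (V^{(j)} ∘ fst)` of FILES 2–4 the natural base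
point is the critical configuration itself, `z₀ j V := critCfgOfRecord ν K j V`: OFF the rebase set `Φ′(V, V^{(j)}(V)) = V^{(j)}(V)` by definition; ON it,
`Φ_tri(V, V^{(j)}(V)) = extend β (c ↦ ϑ_c(V^{(j)}(V), V c)) (V^{(j)}(V))` and each `ϑ_c(V^{(j)}(V), V c)` IS the private coordinate `V^{(j)}(V)(β c)` — because
`V = Ū(V^{(j)}(V))` ((2.3)–(2.4), `Node00.avg_critCfgOfRecord` under [B11]-existence), the private coordinate lies in its central `α`-window ([B7] Prop 2 at the record: the
critical configuration has `2εreg∕L²`-small plaquettes, dag-n09-w1 g2 `…N09NestingOfHierAxial.hcrit_of_ukExists`, and FILE 1 §1 `self_mem_centralWindow_of_plaqSmall` with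
`(((d+2)L)²∕4)·(2εreg∕L²) ≤ α`), and the LEFT-INVERSE clause of the per-bond inversions (`hleft : g ∈ Ωα c U → ϑ_c(U, Ū′(c)(U[β c ↦ g])) = g` — dag-n09-w6 g3's announced
`…N09CentralWindowAtRecord.exists_perBondCharts_of_forwardLaws`, DISPLAYED here in its shape).

WHAT IS PROVED (theorems only; 0 def, 0 instance, 0 notation, 0 sorry).  One level `j < K`.
* §1 `extend_centralBond_self` (`extend β (c ↦ U(β c)) U = U`) · ★ `theta_critCfg_eq_of_hleft` (`ϑ_c(V^{(j)}(V), V c) = V^{(j)}(V)(β c)` for `V ∈ domAlt_{j+1}`) · ★★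
  `triChart_critCfg_eq` (`Φ_tri(V, V^{(j)}(V)) = V^{(j)}(V)`).
* §2 ★★★ `tower_hz0_of_perBondCharts_of_hsolν_of_numerics` — the tower's `hz₀` socket at level `j` for `Φ′` with `z₀ V := critCfgOfRecord θ₀.ν K j V`, binder shape VERBATIM, from
  `hleft` at the central `α`-windows, [B11]-existence `hsolν`, the [B7]-numerics `hεreg hε3 hε2` and `(((d+2)L)²∕4)·(2εreg∕L²) ≤ α`.

HONEST FRAMING.  LOCATED, count-neutral kernel bookkeeping BY NAME; `hleft`, `hsolν` and the numerics stay DISPLAYED; NO Jacobian law, NO continuity socket (`hΦc hJpos hΦV hJV` remain: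
they need the one-bond inverse as a function of the environment — joint continuity ∕ parametric openness); nothing of Bałaban's proved or denied; `hreg` NOT discharged; N09 NOT
discharged; conjunct 1 (Lemma 4) and FLAG №7 untouched; K0⁷ ∕ K1⁹ ∕ K3⁸ NOT closed; counts unmoved (typed 28∕28 · discharged 5∕28); no summit statement is proved by this seat; one finite
four-torus programme at fixed `ε = L^{−K}` per run — R4 closes the conditional rung `BalabanLadder.UV` only; NOT continuum ∕ ℝ⁴ ∕ infinite volume ∕ OS; the Yang–Mills mass gap (Clay)
is NOT proved by any of this.
-/

noncomputable section

namespace Summit.QuantumFields.YangMills.BalabanUVNodes.N09TowerBasePointOfPerBondCharts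

open MeasureTheory Set Function
open scoped ENNReal NNReal
open Literature.MathematicalPhysics.QuantumFieldTheory.Balaban1983to89
open Literature.MathematicalPhysics.QuantumFieldTheory.Balaban1983to89.T4Continuum (T4Family)
open Literature.MathematicalPhysics.QuantumFieldTheory.Balaban1983to89.Node00
open Literature.MathematicalPhysics.QuantumFieldTheory.Balaban1983to89.ExpMeanLog (deltaSU)
open Literature.MathematicalPhysics.QuantumFieldTheory.Balaban1983to89.BlockAveraging (Idx loopHol)
open Literature.MathematicalPhysics.QuantumFieldTheory.Balaban1983to89.BlockAveragingHaarAC (centralBond centralBond_injective pre post)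
open Literature.MathematicalPhysics.QuantumFieldTheory.Balaban1983to89.BlockAveragingEMLHaarAC (fibreFamily)
open N09TowerChartOfPerBondCharts (towerChart_eq_of_mem towerChart_eq_of_not_mem)
open N09SupportClauseAtRecord (self_mem_centralWindow_of_plaqSmall)
open N09NestingOfHierAxial (hcrit_of_ukExists)
open N09LiftInvariance29AtRecord (succ_le_range_of_lt)

variable {F : T4Family} {N : ℕ} [NeZero N]

/-! ## §1  At the critical configuration the private-coordinate chart is the identity -/

section Level

variable {K j : ℕ} (T : PBond (F.P K) (j + 1) → GaugeField (F.P K) j (SU N) → Set (SU N))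
  (ϑ : PBond (F.P K) (j + 1) → GaugeField (F.P K) j (SU N) → SU N → SU N)
  (jd : PBond (F.P K) (j + 1) → GaugeField (F.P K) j (SU N) → SU N → ℝ≥0)

omit [NeZero N] in
/-- Re-inserting a configuration's own private coordinates changes nothing: `extend β (c ↦ U(β c)) U = U` (`β` injective). [cite: Balaban1987RG1, (0.4) p.253 (bookkeeping)] -/
theorem extend_centralBond_self (hj : j < K) (U : GaugeField (F.P K) j (SU N)) :
    (extend centralBond (fun c => U (centralBond c)) U : GaugeField (F.P K) j (SU N)) = U := by
  funext b
  by_cases hb : ∃ c, centralBond c = b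
  · obtain ⟨c, rfl⟩ := hb
    exact (centralBond_injective (succ_le_range_of_lt hj)).extend_apply _ _ c
  · exact extend_apply' _ _ _ hb

/-- ★ **AT THE CRITICAL CONFIGURATION EACH LOCAL INVERSE RETURNS THE PRIVATE COORDINATE**: for `V ∈ domAlt_{j+1}`, `ϑ_c(V^{(j)}(V), V c) = V^{(j)}(V)(β c)` — `V = Ū(V^{(j)}(V))`
(`Node00.avg_critCfgOfRecord`, [B11]-existence), the private coordinate lies in its central `α`-window ([B7] Prop 2 at the record + FILE 1 §1, numerics), and the displayed
LEFT-INVERSE clause `hleft` of the per-bond inversions. [cite: Balaban1987RG1, (2.3)–(2.4) pp.265–266 and (0.4) p.253; Balaban1985Averaging, Prop. 2 (53) p.26] -/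
theorem theta_critCfg_eq_of_hleft (ν : Stage7Numerics) [DecidableEq (PBond (F.P K) j)] (hj : j < K) {α : ℝ}
    (hleft : ∀ (c : PBond (F.P K) (j + 1)) (U : GaugeField (F.P K) j (SU N)) (g' : SU N),
      (∀ i : Idx (F.P K), dist1 (fibreFamily U c (pre U c * g' * post U c) i) ≤ α) →
        ϑ c U ((avOfRecord F N K j).avg (update U (centralBond c) g') c) = g')
    (hεreg : 0 < ν.εreg) (hε3 : (143 * (((((F.P K).d + 4 : ℕ) : ℝ)) ^ 2 / 4) ^ 2) * ν.εreg ≤ 1 / 3)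
    (hε2 : 2 * ν.εreg ≤ 2 * deltaSU (Fin N) / ((((F.P K).d + 4) * (F.P K).L : ℕ) : ℝ) ^ 2)
    (hα : ((((F.P K).d + 2) * (F.P K).L : ℕ) : ℝ) ^ 2 / 4 * (2 * ν.εreg / ((F.P K).L : ℝ) ^ 2) ≤ α)
    {V : PBond (F.P K) (j + 1) → SU N} (hsol : UkExists F N K (j + 1) ν.εreg V) (c : PBond (F.P K) (j + 1)) :
    ϑ c (critCfgOfRecord F N ν K j V) (V c) = critCfgOfRecord F N ν K j V (centralBond c) := by
  set U₀ := critCfgOfRecord F N ν K j V with hU₀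
  have hL0 : (0 : ℝ) < (F.P K).L := by exact_mod_cast (F.P K).L_pos
  have hcrit : PlaqSmall (2 * ν.εreg / ((F.P K).L : ℝ) ^ 2) U₀ :=
    hcrit_of_ukExists ν hεreg hε3 hε2 (by rw [div_mul_cancel₀ _ (by positivity)]) hsol
  have hwin : ∀ i : Idx (F.P K), dist1 (fibreFamily U₀ c (pre U₀ c * U₀ (centralBond c) * post U₀ c) i) ≤ α :=
    self_mem_centralWindow_of_plaqSmall (succ_le_range_of_lt hj) (by positivity) U₀ hcrit hα c
  have h := hleft c U₀ (U₀ (centralBond c)) hwin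
  rw [update_eq_self, avg_critCfgOfRecord hsol] at h
  exact h

/-- ★★ **AT `z₀ = V^{(j)}(V)` THE PRIVATE-COORDINATE CHART RETURNS `V^{(j)}(V)`**: `Φ_tri(V, V^{(j)}(V)) = V^{(j)}(V)` for `V ∈ domAlt_{j+1}` (§1 + `extend_centralBond_self`).
[cite: Balaban1987RG1, (2.3)–(2.4) pp.265–266 and (2.10) p.267] -/
theorem triChart_critCfg_eq (ν : Stage7Numerics) [DecidableEq (PBond (F.P K) j)] (hj : j < K) {α : ℝ}
    (hleft : ∀ (c : PBond (F.P K) (j + 1)) (U : GaugeField (F.P K) j (SU N)) (g' : SU N),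
      (∀ i : Idx (F.P K), dist1 (fibreFamily U c (pre U c * g' * post U c) i) ≤ α) →
        ϑ c U ((avOfRecord F N K j).avg (update U (centralBond c) g') c) = g')
    (hεreg : 0 < ν.εreg) (hε3 : (143 * (((((F.P K).d + 4 : ℕ) : ℝ)) ^ 2 / 4) ^ 2) * ν.εreg ≤ 1 / 3)
    (hε2 : 2 * ν.εreg ≤ 2 * deltaSU (Fin N) / ((((F.P K).d + 4) * (F.P K).L : ℕ) : ℝ) ^ 2)
    (hα : ((((F.P K).d + 2) * (F.P K).L : ℕ) : ℝ) ^ 2 / 4 * (2 * ν.εreg / ((F.P K).L : ℝ) ^ 2) ≤ α)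
    {V : PBond (F.P K) (j + 1) → SU N} (hsol : UkExists F N K (j + 1) ν.εreg V) :
    (extend centralBond (fun c => ϑ c (critCfgOfRecord F N ν K j V) (V c)) (critCfgOfRecord F N ν K j V) : GaugeField (F.P K) j (SU N)) =
      critCfgOfRecord F N ν K j V := by
  have h : (fun c => ϑ c (critCfgOfRecord F N ν K j V) (V c)) = fun c => critCfgOfRecord F N ν K j V (centralBond c) :=
    funext fun c => theta_critCfg_eq_of_hleft ϑ ν hj hleft hεreg hε3 hε2 hα hsol c
  rw [h]
  exact extend_centralBond_self hj _

end Level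

/-! ## §2  The base-point socket of the tower for the re-based road-A′ chart -/

/-- ★★★ **SOCKET `hz₀` AT LEVEL `j` FOR ROAD A′ RE-BASED ON THE χ-SUPPORT, BINDER SHAPE OF THE TOWER VERBATIM** (`Φ j := Φ′` of `…N09TowerChartOfPerBondCharts[AtRecord]`,
`z₀ j V := critCfgOfRecord θ₀.ν K j V`): for every `V ∈ domAlt_{j+1}`, `Φ′(V, V^{(j)}(V)) = V^{(j)}(V)` — on the rebase set by §1 (`hleft` at the central `α`-windows + [B7] Prop 2 +
numerics), off it by the fallback.  CONDITIONAL; `hleft` (dag-n09-w6 g3's announced left-inverse clause), `hsolν` and the numerics are displayed; nothing of Bałaban's asserted.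
[cite: Balaban1987RG1, (2.3)–(2.4) pp.265–266, (2.10) p.267 and (0.4) p.253; Balaban1985Averaging, Prop. 2 (53) p.26; Balaban1985Variational, Thm 1 (8)–(10) p.279] -/
theorem tower_hz0_of_perBondCharts_of_hsolν_of_numerics (θ₀ : Stage13Params F N) (K : ℕ) (g : ℕ → ℝ) {j : ℕ}
    [DecidableEq (PBond (F.P K) j)] (hj : j < K) {α : ℝ}
    (T : PBond (F.P K) (j + 1) → GaugeField (F.P K) j (SU N) → Set (SU N))
    (ϑ : PBond (F.P K) (j + 1) → GaugeField (F.P K) j (SU N) → SU N → SU N)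
    (jd : PBond (F.P K) (j + 1) → GaugeField (F.P K) j (SU N) → SU N → ℝ≥0)
    (hleft : ∀ (c : PBond (F.P K) (j + 1)) (U : GaugeField (F.P K) j (SU N)) (g' : SU N),
      (∀ i : Idx (F.P K), dist1 (fibreFamily U c (pre U c * g' * post U c) i) ≤ α) →
        ϑ c U ((avOfRecord F N K j).avg (update U (centralBond c) g') c) = g')
    (hεreg : 0 < θ₀.ν.εreg) (hε3 : (143 * (((((F.P K).d + 4 : ℕ) : ℝ)) ^ 2 / 4) ^ 2) * θ₀.ν.εreg ≤ 1 / 3)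
    (hε2 : 2 * θ₀.ν.εreg ≤ 2 * deltaSU (Fin N) / ((((F.P K).d + 4) * (F.P K).L : ℕ) : ℝ) ^ 2)
    (hα : ((((F.P K).d + 2) * (F.P K).L : ℕ) : ℝ) ^ 2 / 4 * (2 * θ₀.ν.εreg / ((F.P K).L : ℝ) ^ 2) ≤ α)
    (hsolν : ∀ j < K, ∀ W ∈ domAltOfRecord F N θ₀.ν K (j + 1), UkExists F N K (j + 1) θ₀.ν.εreg W)
    [DecidablePred (· ∈ {p : ((PBond (F.P K) (j + 1) → SU N) × GaugeField (F.P K) j (SU N)) |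
          ({q : ((PBond (F.P K) (j + 1) → SU N) × GaugeField (F.P K) j (SU N)) | ∀ c, q.1 c ∈ T c q.2}.indicator fun q => ∏ c, jd c q.2 (q.1 c)) p ≠ 0 ∧
            (extend centralBond (fun c => ϑ c p.2 (p.1 c)) p.2 : GaugeField (F.P K) j (SU N)) ∈
              {U : GaugeField (F.P K) j (SU N) | chiFixed29 F N θ₀.ν θ₀.ε₂₉ K g j U ≠ 0}})] :
    ∀ V ∈ domAltOfRecord F N θ₀.ν K (j + 1),
      (Set.piecewise {p : ((PBond (F.P K) (j + 1) → SU N) × GaugeField (F.P K) j (SU N)) |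
          ({q : ((PBond (F.P K) (j + 1) → SU N) × GaugeField (F.P K) j (SU N)) | ∀ c, q.1 c ∈ T c q.2}.indicator fun q => ∏ c, jd c q.2 (q.1 c)) p ≠ 0 ∧
            (extend centralBond (fun c => ϑ c p.2 (p.1 c)) p.2 : GaugeField (F.P K) j (SU N)) ∈
              {U : GaugeField (F.P K) j (SU N) | chiFixed29 F N θ₀.ν θ₀.ε₂₉ K g j U ≠ 0}}
        (fun p => (extend centralBond (fun c => ϑ c p.2 (p.1 c)) p.2 : GaugeField (F.P K) j (SU N)))
        (fun p => critCfgOfRecord F N θ₀.ν K j p.1)) (V, critCfgOfRecord F N θ₀.ν K j V) = critCfgOfRecord F N θ₀.ν K j V := by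
  intro V hV
  by_cases hAz : (V, critCfgOfRecord F N θ₀.ν K j V) ∈ {p : ((PBond (F.P K) (j + 1) → SU N) × GaugeField (F.P K) j (SU N)) |
          ({q : ((PBond (F.P K) (j + 1) → SU N) × GaugeField (F.P K) j (SU N)) | ∀ c, q.1 c ∈ T c q.2}.indicator fun q => ∏ c, jd c q.2 (q.1 c)) p ≠ 0 ∧
            (extend centralBond (fun c => ϑ c p.2 (p.1 c)) p.2 : GaugeField (F.P K) j (SU N)) ∈
              {U : GaugeField (F.P K) j (SU N) | chiFixed29 F N θ₀.ν θ₀.ε₂₉ K g j U ≠ 0}}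
  · exact (towerChart_eq_of_mem T ϑ jd _ _ hAz).trans (triChart_critCfg_eq ϑ θ₀.ν hj hleft hεreg hε3 hε2 hα (hsolν j hj V hV))
  · exact towerChart_eq_of_not_mem T ϑ jd _ _ hAz

end Summit.QuantumFields.YangMills.BalabanUVNodes.N09TowerBasePointOfPerBondCharts

end
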